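import Summits.Ventures.YMGap.RobustBall.OneStateInvariant
import Summits.Ventures.YMGap.RobustBall.PairWitnessesMassive
import Summits.Ventures.YMGap.RobustBall.AxialPairRows
import HarnessLib

/-!
# Venture YMGap, track ROBUST-BALL — ONE STATE, step 11: the INFINITE-RANGE two-plaquette members are translation
# covariant — their one state is translation invariant (tier 2, no Van Hove join)

HONEST FRAMING. WHAT THIS IS: a venture file (cell `pub-ymgap`, track Y2 ROBUST-BALL, seat ds-3) checking the
translation covariance hypothesis `W_{X+v}(θ_v U) = W_X(U)` of `OneStateInvariant.lean` /
`PerturbedCovariance.lean` for rb-p1's INDEXED members of the tier-2 (weighted, summable, infinite-range) ball: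
* generic: an indexed potential `W_X = ∑_{i ∈ fib X} φ_i` (rb-p1's `indexedPotential`) is translation covariant as
  soon as the index set carries a translation `sh_v` with `fib (X + v) = sh_v (fib X)` and `φ_{sh_v i} ∘ θ_v = φ_i`
  (`indexedPotential_shift`);
* the TWO-PLAQUETTE COUPLINGS `plaqPairCoupling N J` (`∑_{(p,q)} J(p,q) (Re tr U_p/N)(Re tr U_q/N)`) are covariant for
  every translation-invariant coupling `J(p+v, q+v) = J(p, q)` (`plaqPairCoupling_shift`), in particular the
  ISOTROPIC member `isotropicPairWitness N τ κ` (`J = τ κ^{‖x_p − x_q‖₁}`, `isotropicPairWitness_shift`); the AXIAL-PAIR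
  witness `axialPairWitness N τ κ` (all pairs of parallel plaquettes on a common axis, `τ κ^{dist}`) is covariant
  (`axialPairWitness_shift`);
* CELLS (hypothesis-free, by name, TIER 2 = infinite range): the unique DLR state of `SU(2)` Wilson on `ℤ⁴` at
  `β_W = 1/16` plus ALL plaquette-pair couplings `τ (1/10)^{‖x_p−x_q‖₁}(Re tr U_p/2)(Re tr U_q/2)`, `|τ| ≤ 1/10000`,
  is TRANSLATION INVARIANT (`su2_isotropicPair_oneState_translationInvariant`, rb-p1's `su2_isotropicPair_massGapS_1_16`);
  every `N ≥ 2` at 't Hooft `1/64`, `|τ| ≤ 1/12000` (`suN_isotropicPair_oneState_translationInvariant`); the axial-pair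
  member at `β_W = 1/16`, `|τ| ≤ 1/320` (`su2_axialPair_oneState_translationInvariant`), at `β_W = 1/20`, `|τ| ≤ 1/600`
  (`su2_axialPair_oneState_translationInvariant_1_20`), and every `N ≥ 2` at 't Hooft `1/64`, `|τ| ≤ 1/420`
  (`suN_axialPair_oneState_translationInvariant`).
WHAT THIS IS NOT: lattice strong-coupling statements; nothing about the continuum limit or the Clay Millennium
problem.

References: H.-O. Georgii (2011), §5.1; the track's `IndexedMember.lean`, `PairCoupling(Geometry).lean`,
`IsotropicPairWitness.lean`, `AxialPair{Geometry,Term,Witness,Rows}.lean`, `PairWitnessesMassive.lean`,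
`OneStateInvariant.lean`.
-/

noncomputable section

open MeasureTheory Filter Function Finset
open Literature.Probability.LatticeModels hiding configShift configShift_apply
open Literature.MathematicalPhysics.QuantumLattice
open Literature.MathematicalPhysics.QuantumFieldTheory hiding ZdEdge
open Summit.QuantumFields.YangMills.Theorems.NonSimplyConnectedLatticeGap
  (plaquetteEdges_shift plaquetteObs_add_configShift)

namespace Summit.Ventures.YMGap.RobustBall

variable {d N : ℕ}

/-! ### Generic: indexed potentials with a translation on the index set -/

/-- **An indexed potential with a compatible index translation is translation covariant**: if
`fib (X + v) = sh_v '' fib X`, `sh_v` is injective and `φ_{sh_v i}(θ_v U) = φ_i(U)`, then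
`W_{X+v}(θ_v U) = W_X(U)` for `W = indexedPotential fib φ`. [folklore] -/
theorem indexedPotential_shift {ι : Type*} {fib : Finset (ZdEdge d) → Finset ι}
    {φ : ι → LGConfig d (Matrix.specialUnitaryGroup (Fin N) ℂ) → ℝ} (sh : Site d → ι → ι)
    (hfib : ∀ (v : Site d) (X : Finset (ZdEdge d)) (i : ι),
      i ∈ fib (X.map (edgeShift v).toEmbedding) ↔ ∃ j ∈ fib X, sh v j = i)
    (hinj : ∀ v : Site d, Function.Injective (sh v))
    (hφ : ∀ (v : Site d) (i : ι) (U : LGConfig d (Matrix.specialUnitaryGroup (Fin N) ℂ)),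
      φ (sh v i) (configShift v U) = φ i U)
    (v : Site d) (X : Finset (ZdEdge d)) (U : LGConfig d (Matrix.specialUnitaryGroup (Fin N) ℂ)) :
    indexedPotential fib φ (X.map (edgeShift v).toEmbedding) (configShift v U) = indexedPotential fib φ X U := by
  classical
  have hset : fib (X.map (edgeShift v).toEmbedding) = (fib X).image (sh v) := by
    ext i
    rw [hfib, Finset.mem_image]
  rw [indexedPotential_apply, indexedPotential_apply, hset, Finset.sum_image fun j _ k _ h => hinj v h]
  exact Finset.sum_congr rfl fun i _ => hφ v i U

/-! ### Translating plaquettes -/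

/-- The normalised plaquette observable is translation covariant. [folklore] -/
theorem plaqObsN_shift (v : Site d) (p : ZdPlaquette d) (U : LGConfig d (Matrix.specialUnitaryGroup (Fin N) ℂ)) :
    plaqObsN N ((p.1 + v, p.2) : ZdPlaquette d) (configShift v U) = plaqObsN N p U := by
  unfold plaqObsN
  rw [plaquetteObs_add_configShift]

/-! ### Two-plaquette couplings with a translation-invariant coupling function -/

section Pairs

/-- Translating a plaquette pair. -/
theorem plaqPairCode_shift (v : Site d) (i : PlaqPairIdx d) :
    plaqPairCode ((((i.1.1 + v, i.1.2) : ZdPlaquette d), ((i.2.1 + v, i.2.2) : ZdPlaquette d)) : PlaqPairIdx d) =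
      (plaqPairCode i).map (edgeShift v).toEmbedding := by
  rw [plaqPairCode, plaqPairCode, Finset.map_union, ← plaquetteEdges_shift, ← plaquetteEdges_shift]

/-- **The fibre of a translated link set consists of the translated pairs.** [folklore] -/
theorem mem_plaqPairFib_map_iff (v : Site d) (X : Finset (ZdEdge d)) (i : PlaqPairIdx d) :
    i ∈ plaqPairFib (X.map (edgeShift v).toEmbedding) ↔
      ∃ j ∈ plaqPairFib X,
        ((((j.1.1 + v, j.1.2) : ZdPlaquette d), ((j.2.1 + v, j.2.2) : ZdPlaquette d)) : PlaqPairIdx d) = i := by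
  rw [mem_plaqPairFib]
  constructor
  · intro h
    refine ⟨(((i.1.1 + -v, i.1.2) : ZdPlaquette d), ((i.2.1 + -v, i.2.2) : ZdPlaquette d)), ?_, ?_⟩
    · rw [mem_plaqPairFib, plaqPairCode_shift, h, map_edgeShift_map_neg]
    · simp
  · rintro ⟨j, hj, rfl⟩
    rw [mem_plaqPairFib] at hj
    rw [plaqPairCode_shift, hj]

/-- ★ **Every two-plaquette coupling with translation-invariant couplings `J(p+v, q+v) = J(p, q)` is a
translation-covariant potential.** [folklore] -/
theorem plaqPairCoupling_shift {J : PlaqPairIdx d → ℝ}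
    (hJ : ∀ (v : Site d) (i : PlaqPairIdx d),
      J ((((i.1.1 + v, i.1.2) : ZdPlaquette d), ((i.2.1 + v, i.2.2) : ZdPlaquette d)) : PlaqPairIdx d) = J i)
    (v : Site d) (X : Finset (ZdEdge d)) (U : LGConfig d (Matrix.specialUnitaryGroup (Fin N) ℂ)) :
    plaqPairCoupling N J (X.map (edgeShift v).toEmbedding) (configShift v U) = plaqPairCoupling N J X U := by
  refine indexedPotential_shift
    (fun v i => ((((i.1.1 + v, i.1.2) : ZdPlaquette d), ((i.2.1 + v, i.2.2) : ZdPlaquette d)) : PlaqPairIdx d))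
    (fun v X i => mem_plaqPairFib_map_iff v X i) (fun v j k h => ?_) (fun v i U => ?_) v X U
  · simp only [Prod.mk.injEq, add_left_inj] at h
    exact Prod.ext (Prod.ext h.1.1 h.1.2) (Prod.ext h.2.1 h.2.2)
  · simp only [plaqPairTerm, hJ, plaqObsN_shift]

/-- The isotropic couplings `τ κ^{‖x_p − x_q‖₁}` are translation invariant. [folklore] -/
theorem isoJ_shift (τ κ : ℝ) (v : Site d) (i : PlaqPairIdx d) :
    isoJ τ κ ((((i.1.1 + v, i.1.2) : ZdPlaquette d), ((i.2.1 + v, i.2.2) : ZdPlaquette d)) : PlaqPairIdx d) =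
      isoJ τ κ i := by
  simp only [isoJ, add_sub_add_right_eq_sub]

/-- ★ **The isotropic two-plaquette member is translation covariant.** [folklore] -/
theorem isotropicPairWitness_shift (τ κ : ℝ) (v : Site d) (X : Finset (ZdEdge d))
    (U : LGConfig d (Matrix.specialUnitaryGroup (Fin N) ℂ)) :
    isotropicPairWitness N τ κ (X.map (edgeShift v).toEmbedding) (configShift v U) = isotropicPairWitness N τ κ X U :=
  plaqPairCoupling_shift (isoJ_shift τ κ) v X U

/-- ★★ **`SU(2)`, `ℤ⁴`, `β_W = 1/16` + ALL plaquette-pair couplings `τ (1/10)^{‖x_p−x_q‖₁}(Re tr U_p/2)(Re tr U_q/2)`,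
`|τ| ≤ 1/10000` (INFINITE RANGE): ONE DLR STATE, TRANSLATION INVARIANT** (rb-p1's `su2_isotropicPair_massGapS_1_16`).
[folklore] -/
theorem su2_isotropicPair_oneState_translationInvariant {τ : ℝ} (hτ : |τ| ≤ 1 / 10000) :
    ∃ μ : Measure (LGConfig 4 (SUN 2)),
      perturbedGibbsMeasuresS (d := 4) (fundamentalRep (Fin 2)) (((2 : ℕ) : ℝ) * ((1 / 16 : ℝ) / 4))
          (isotropicPairWitness (d := 4) 2 τ (1 / 10)) = {μ} ∧ IsZdTranslationInvariant μ := by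
  have hmem := memBallZdS_isotropicPairWitness (d := 4) (N := 2) (τ := τ) (κ := 1 / 10) (t := 0)
    (by norm_num) (by norm_num) (by norm_num) (by norm_num) le_rfl (by rw [Real.exp_zero]; norm_num)
  obtain ⟨B, hB⟩ := hmem.summable
  exact oneState_translationInvariant_of_perturbedMassGapAtS (su2_isotropicPair_massGapS_1_16 hτ) hB hmem.continuous
    hmem.dependsOn (fun v X U => isotropicPairWitness_shift τ _ v X U)

/-- ★★ **Every `N ≥ 2`, `ℤ⁴`, 't Hooft `1/64` + the isotropic pair member, `|τ| ≤ 1/12000`: ONE DLR STATE, TRANSLATION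
INVARIANT** (`suN_isotropicPair_massGapS_1_64`). [folklore] -/
theorem suN_isotropicPair_oneState_translationInvariant (hN : 2 ≤ N) {τ : ℝ} (hτ : |τ| ≤ 1 / 12000) :
    ∃ μ : Measure (LGConfig 4 (SUN N)),
      perturbedGibbsMeasuresS (d := 4) (fundamentalRep (Fin N)) ((N : ℝ) * (1 / 64))
          (isotropicPairWitness (d := 4) N τ (1 / 10)) = {μ} ∧ IsZdTranslationInvariant μ := by
  have hmem := memBallZdS_isotropicPairWitness (d := 4) (N := N) (τ := τ) (κ := 1 / 10) (t := 0)
    (by norm_num) (by omega) (by norm_num) (by norm_num) le_rfl (by rw [Real.exp_zero]; norm_num)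
  obtain ⟨B, hB⟩ := hmem.summable
  exact oneState_translationInvariant_of_perturbedMassGapAtS (suN_isotropicPair_massGapS_1_64 hN hτ) hB
    hmem.continuous hmem.dependsOn (fun v X U => isotropicPairWitness_shift τ _ v X U)

end Pairs

/-! ### The axial-pair witness -/

section Axial

/-- Translating an axial index: the plaquette moves, direction and gap stay. -/
theorem partner_shift (v : Site d) (i : AxialIdx d) :
    partner ((((i.1.1 + v, i.1.2) : ZdPlaquette d), i.2) : AxialIdx d) =
      (((partner i).1 + v, (partner i).2) : ZdPlaquette d) := by
  simp only [partner, add_right_comm _ v]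

/-- The carrier of the translated axial index is the translated carrier. [folklore] -/
theorem axialCode_shift (v : Site d) (i : AxialIdx d) :
    axialCode ((((i.1.1 + v, i.1.2) : ZdPlaquette d), i.2) : AxialIdx d) = (axialCode i).map (edgeShift v).toEmbedding := by
  rw [axialCode, axialCode, partner_shift, Finset.map_union, ← plaquetteEdges_shift, ← plaquetteEdges_shift]

/-- **The axial fibre of a translated link set consists of the translated indices.** [folklore] -/
theorem mem_axialFib_map_iff (v : Site d) (X : Finset (ZdEdge d)) (i : AxialIdx d) :
    i ∈ axialFib (X.map (edgeShift v).toEmbedding) ↔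
      ∃ j ∈ axialFib X, ((((j.1.1 + v, j.1.2) : ZdPlaquette d), j.2) : AxialIdx d) = i := by
  rw [mem_axialFib]
  constructor
  · intro h
    refine ⟨((((i.1.1 + -v, i.1.2) : ZdPlaquette d), i.2) : AxialIdx d), ?_, ?_⟩
    · rw [mem_axialFib, axialCode_shift, h, map_edgeShift_map_neg]
    · simp
  · rintro ⟨j, hj, rfl⟩
    rw [mem_axialFib] at hj
    rw [axialCode_shift, hj]

/-- ★ **The axial-pair witness is translation covariant.** [folklore] -/
theorem axialPairWitness_shift (τ κ : ℝ) (v : Site d) (X : Finset (ZdEdge d))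
    (U : LGConfig d (Matrix.specialUnitaryGroup (Fin N) ℂ)) :
    axialPairWitness N τ κ (X.map (edgeShift v).toEmbedding) (configShift v U) = axialPairWitness N τ κ X U := by
  refine indexedPotential_shift (fun v i => ((((i.1.1 + v, i.1.2) : ZdPlaquette d), i.2) : AxialIdx d))
    (fun v X i => mem_axialFib_map_iff v X i) (fun v j k h => ?_) (fun v i U => ?_) v X U
  · simp only [Prod.mk.injEq, add_left_inj] at h
    exact Prod.ext (Prod.ext h.1.1 h.1.2) h.2
  · simp only [axialTerm, partner_shift, plaqObsN_shift]

/-- ★★ **`SU(2)`, `ℤ⁴`, `β_W = 1/16` + ALL axial plaquette-pair couplings `τ (1/10)^{dist}`, `|τ| ≤ 1/320` (INFINITE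
RANGE): ONE DLR STATE, TRANSLATION INVARIANT** (rb-p1's `su2_axialPair_massGapS_1_16`). [folklore] -/
theorem su2_axialPair_oneState_translationInvariant {τ : ℝ} (hτ : |τ| ≤ 1 / 320) :
    ∃ μ : Measure (LGConfig 4 (SUN 2)),
      perturbedGibbsMeasuresS (d := 4) (fundamentalRep (Fin 2)) (((2 : ℕ) : ℝ) * ((1 / 16 : ℝ) / 4))
          (axialPairWitness (d := 4) 2 τ (1 / 10)) = {μ} ∧ IsZdTranslationInvariant μ := by
  have hmem := memBallZdS_axialPairWitness (d := 4) (N := 2) (τ := τ) (κ := 1 / 10) (t := 0)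
    (by norm_num) (by norm_num) (by norm_num) (by norm_num) le_rfl (by rw [Real.exp_zero]; norm_num)
  obtain ⟨B, hB⟩ := hmem.summable
  exact oneState_translationInvariant_of_perturbedMassGapAtS (su2_axialPair_massGapS_1_16 hτ) hB hmem.continuous
    hmem.dependsOn (fun v X U => axialPairWitness_shift τ _ v X U)

/-- ★★ **`SU(2)`, `ℤ⁴`, `β_W = 1/20` + the axial-pair member, `|τ| ≤ 1/600`: ONE DLR STATE, TRANSLATION INVARIANT**
(`su2_axialPair_massGapS_1_20`). [folklore] -/
theorem su2_axialPair_oneState_translationInvariant_1_20 {τ : ℝ} (hτ : |τ| ≤ 1 / 600) :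
    ∃ μ : Measure (LGConfig 4 (SUN 2)),
      perturbedGibbsMeasuresS (d := 4) (fundamentalRep (Fin 2)) (((2 : ℕ) : ℝ) * ((1 / 20 : ℝ) / 4))
          (axialPairWitness (d := 4) 2 τ (1 / 10)) = {μ} ∧ IsZdTranslationInvariant μ := by
  have hmem := memBallZdS_axialPairWitness (d := 4) (N := 2) (τ := τ) (κ := 1 / 10) (t := 0)
    (by norm_num) (by norm_num) (by norm_num) (by norm_num) le_rfl (by rw [Real.exp_zero]; norm_num)
  obtain ⟨B, hB⟩ := hmem.summable
  exact oneState_translationInvariant_of_perturbedMassGapAtS (su2_axialPair_massGapS_1_20 hτ) hB hmem.continuous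
    hmem.dependsOn (fun v X U => axialPairWitness_shift τ _ v X U)

/-- ★★ **Every `N ≥ 2`, `ℤ⁴`, 't Hooft `1/64` + the axial-pair member, `|τ| ≤ 1/420`: ONE DLR STATE, TRANSLATION
INVARIANT** (`suN_axialPair_massGapS_1_64`). [folklore] -/
theorem suN_axialPair_oneState_translationInvariant (hN : 2 ≤ N) {τ : ℝ} (hτ : |τ| ≤ 1 / 420) :
    ∃ μ : Measure (LGConfig 4 (SUN N)),
      perturbedGibbsMeasuresS (d := 4) (fundamentalRep (Fin N)) ((N : ℝ) * (1 / 64))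
          (axialPairWitness (d := 4) N τ (1 / 10)) = {μ} ∧ IsZdTranslationInvariant μ := by
  have hmem := memBallZdS_axialPairWitness (d := 4) (N := N) (τ := τ) (κ := 1 / 10) (t := 0)
    (by norm_num) (by omega) (by norm_num) (by norm_num) le_rfl (by rw [Real.exp_zero]; norm_num)
  obtain ⟨B, hB⟩ := hmem.summable
  exact oneState_translationInvariant_of_perturbedMassGapAtS (suN_axialPair_massGapS_1_64 hN hτ) hB
    hmem.continuous hmem.dependsOn (fun v X U => axialPairWitness_shift τ _ v X U)

end Axial

end Summit.Ventures.YMGap.RobustBall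

end
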